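import Summits.ResolutionOfSingularities.ResolutionOfSingularities.Theorems.RadicialJungCleanModelsSufficeGamePointData

/-!
# Route `RadicialJung`, crux `CleanModelsSuffice`, line `Sketch`: one round over the centre — counting old charged coordinates

Helper for the registered stub `stub_gameRoundOver` of the skeleton of
`Summit.ResolutionOfSingularities.ResolutionOfSingularities.Theses.RadicialJung.CleanModelsSuffice`
(stmt-ResolutionOfSingularities-15883): COUNTING the old charged coordinates before and after one round over the
centre. Downstairs the coordinates at `v` are enumerated by the centre positions `σ` and the others `σ'`; upstairs
the coordinates of the pointwise data `P` at `x` are labelled by `lab' : Option (Fin a ⊕ G) → Fin P.d`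
(exceptional / non-centre / good centre positions):

* `roundOver_mem_oldCh_iff`, `roundOver_oldCh_eq` — the old charged coordinates of `P` are the images of the
  non-centre and good positions whose coordinate at `v` was old charged;
* `roundOver_mOld_eq`, `roundOver_mOld_eq_base` — the two counts.
-/

noncomputable section

set_option linter.dupNamespace false -- mandated namespace of this single-conjunct summit

open CategoryTheory AlgebraicGeometry TopologicalSpace IsLocalRing
open Literature.AlgebraicGeometry.Resolution Literature.AlgebraicGeometry.Motives

namespace Summit.ResolutionOfSingularities.ResolutionOfSingularities.Theorems.RadicialJung.CleanModelsSuffice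

variable {p : ℕ} {V₀ : Scheme.{0}} [IsIntegral V₀] {L : Type} [Field L] [Algebra V₀.functionField L]
  {V : Scheme.{0}} [IsIntegral V] {π : V ⟶ V₀} [IsDominant π] {V' : Scheme.{0}}

/-- **The old charged coordinates upstairs.** For pointwise data `P` at `x` whose coordinates are labelled by
`lab' : Option (Fin a ⊕ G) → Fin P.d` (exceptional / non-centre / good centre positions) with exponents `aOf` and whose
boundary positions are exactly: the exceptional one, the non-centre ones that were boundary at `v`, and the good centre
ones that were boundary at `v` — the old charged coordinates of `P` are the images of the non-centre and good positions
whose coordinate at `v` was old charged. [folklore] -/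
theorem roundOver_mem_oldCh_iff (S : GameState p V₀ L V π) (v : V) [IsIntegral V'] {ψ : V' ⟶ V₀} [IsDominant ψ]
    {E' : List V'.IdealSheafData} {x : V'} (P : GameState.PointData p V₀ L V' ψ E' x)
    {r a : ℕ} {G : Type} (gval : G → Fin r)
    (σ : Fin r → Fin (S.d v)) (σ' : Fin a → Fin (S.d v))
    (lab' : Option (Fin a ⊕ G) → Fin P.d)
    (aOf : Option (Fin a ⊕ G) → ℕ) (haOfl : ∀ m, aOf (some (Sum.inl m)) = S.a v (σ' m))
    (haOfr : ∀ g, aOf (some (Sum.inr g)) = S.a v (σ (gval g)))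
    (hPa : ∀ o, P.a (lab' o) = aOf o) (hPa0 : ∀ i', (¬ ∃ o, lab' o = i') → P.a i' = 0)
    (hPlab : ∀ o, lab' o ∈ Set.range P.lab ↔ (o = none ∨ (∃ m, o = some (Sum.inl m) ∧ S.IsLab v (σ' m)) ∨
      (∃ g, o = some (Sum.inr g) ∧ S.IsLab v (σ (gval g))))) (i' : Fin P.d) :
    i' ∈ P.oldCh ↔ (∃ m, σ' m ∈ S.oldCh v ∧ lab' (some (Sum.inl m)) = i') ∨
      (∃ g, σ (gval g) ∈ S.oldCh v ∧ lab' (some (Sum.inr g)) = i') := by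
  classical
  have hmemS : ∀ t, t ∈ S.oldCh v ↔ S.a v t ≠ 0 ∧ ¬ S.IsLab v t := fun t => by
    simp [GameState.oldCh, GameState.ch]
  have hmemP : ∀ i', i' ∈ P.oldCh ↔ P.a i' ≠ 0 ∧ ¬ P.IsLab i' := fun i' => by
    simp [GameState.PointData.oldCh, GameState.PointData.ch]
  rw [hmemP]
  constructor
  · rintro ⟨ha, hl⟩
    have hex : ∃ o, lab' o = i' := by
      by_contra h; exact ha (hPa0 i' h)
    obtain ⟨o, rfl⟩ := hex
    rw [hPa] at ha
    have hnl : ¬ (o = none ∨ (∃ m, o = some (Sum.inl m) ∧ S.IsLab v (σ' m)) ∨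
        (∃ g, o = some (Sum.inr g) ∧ S.IsLab v (σ (gval g)))) := fun h => hl ((hPlab o).mpr h)
    rcases o with _ | ⟨m⟩ | ⟨g⟩
    · exact absurd (Or.inl rfl) hnl
    · left
      refine ⟨m, (hmemS _).mpr ⟨?_, fun hL => hnl ?_⟩, rfl⟩
      · rwa [haOfl] at ha
      · exact Or.inr (Or.inl ⟨m, rfl, hL⟩)
    · right
      refine ⟨g, (hmemS _).mpr ⟨?_, fun hL => hnl ?_⟩, rfl⟩
      · rwa [haOfr] at ha
      · exact Or.inr (Or.inr ⟨g, rfl, hL⟩)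
  · rintro (⟨m, hm, rfl⟩ | ⟨g, hg, rfl⟩)
    · obtain ⟨ha, hl⟩ := (hmemS _).mp hm
      refine ⟨by rwa [hPa, haOfl], fun hL => ?_⟩
      rcases (hPlab _).mp hL with h | ⟨m', hm', hL'⟩ | ⟨g, hg, -⟩
      · exact absurd h (by simp)
      · have : m' = m := by simpa using hm'.symm
        subst this; exact hl hL'
      · exact absurd hg (by simp)
    · obtain ⟨ha, hl⟩ := (hmemS _).mp hg
      refine ⟨by rwa [hPa, haOfr], fun hL => ?_⟩
      rcases (hPlab _).mp hL with h | ⟨m, hm, -⟩ | ⟨g', hg', hL'⟩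
      · exact absurd h (by simp)
      · exact absurd hm (by simp)
      · have : g' = g := by simpa using hg'.symm
        subst this; exact hl hL'

/-- The `Finset` form of `roundOver_mem_oldCh_iff`. [folklore] -/
theorem roundOver_oldCh_eq (S : GameState p V₀ L V π) (v : V) [IsIntegral V'] {ψ : V' ⟶ V₀} [IsDominant ψ]
    {E' : List V'.IdealSheafData} {x : V'} (P : GameState.PointData p V₀ L V' ψ E' x)
    {r a : ℕ} {G : Type} [Fintype G] [DecidableEq G] (gval : G → Fin r)
    (σ : Fin r → Fin (S.d v)) (σ' : Fin a → Fin (S.d v))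
    (lab' : Option (Fin a ⊕ G) → Fin P.d)
    (aOf : Option (Fin a ⊕ G) → ℕ) (haOfl : ∀ m, aOf (some (Sum.inl m)) = S.a v (σ' m))
    (haOfr : ∀ g, aOf (some (Sum.inr g)) = S.a v (σ (gval g)))
    (hPa : ∀ o, P.a (lab' o) = aOf o) (hPa0 : ∀ i', (¬ ∃ o, lab' o = i') → P.a i' = 0)
    (hPlab : ∀ o, lab' o ∈ Set.range P.lab ↔ (o = none ∨ (∃ m, o = some (Sum.inl m) ∧ S.IsLab v (σ' m)) ∨
      (∃ g, o = some (Sum.inr g) ∧ S.IsLab v (σ (gval g))))) :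
    P.oldCh = (Finset.univ.filter fun m => σ' m ∈ S.oldCh v).image (fun m => lab' (some (Sum.inl m))) ∪
      (Finset.univ.filter fun g => σ (gval g) ∈ S.oldCh v).image (fun g => lab' (some (Sum.inr g))) := by
  ext i'
  rw [roundOver_mem_oldCh_iff S v P gval σ σ' lab' aOf haOfl haOfr hPa hPa0 hPlab i', Finset.mem_union,
    Finset.mem_image, Finset.mem_image]
  simp only [Finset.mem_filter, Finset.mem_univ, true_and]

/-- The cardinality form of `roundOver_oldCh_eq`. [folklore] -/
theorem roundOver_mOld_eq (S : GameState p V₀ L V π) (v : V) [IsIntegral V'] {ψ : V' ⟶ V₀} [IsDominant ψ]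
    {E' : List V'.IdealSheafData} {x : V'} (P : GameState.PointData p V₀ L V' ψ E' x)
    {r a : ℕ} {G : Type} [Fintype G] [DecidableEq G] (gval : G → Fin r)
    (σ : Fin r → Fin (S.d v)) (σ' : Fin a → Fin (S.d v))
    (lab' : Option (Fin a ⊕ G) → Fin P.d) (hlab' : Function.Injective lab')
    (aOf : Option (Fin a ⊕ G) → ℕ) (haOfl : ∀ m, aOf (some (Sum.inl m)) = S.a v (σ' m))
    (haOfr : ∀ g, aOf (some (Sum.inr g)) = S.a v (σ (gval g)))
    (hPa : ∀ o, P.a (lab' o) = aOf o) (hPa0 : ∀ i', (¬ ∃ o, lab' o = i') → P.a i' = 0)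
    (hPlab : ∀ o, lab' o ∈ Set.range P.lab ↔ (o = none ∨ (∃ m, o = some (Sum.inl m) ∧ S.IsLab v (σ' m)) ∨
      (∃ g, o = some (Sum.inr g) ∧ S.IsLab v (σ (gval g))))) :
    P.mOld = (Finset.univ.filter fun m => σ' m ∈ S.oldCh v).card +
      (Finset.univ.filter fun g => σ (gval g) ∈ S.oldCh v).card := by
  classical
  unfold GameState.PointData.mOld
  rw [roundOver_oldCh_eq S v P gval σ σ' lab' aOf haOfl haOfr hPa hPa0 hPlab,
    Finset.card_union_of_disjoint, Finset.card_image_of_injective _ (fun m m' h => by simpa using hlab' h),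
    Finset.card_image_of_injective _ (fun g g' h => by simpa using hlab' h)]
  rw [Finset.disjoint_left]
  rintro i' hm hg
  obtain ⟨m, -, rfl⟩ := Finset.mem_image.mp hm
  obtain ⟨g, -, hg'⟩ := Finset.mem_image.mp hg
  exact absurd (hlab' hg') (by simp)

/-- **Counting the old charged coordinates downstairs** along the two enumerations. [folklore] -/
theorem roundOver_mOld_eq_base (S : GameState p V₀ L V π) (v : V) {r a : ℕ}
    (σ : Fin r → Fin (S.d v)) (σ' : Fin a → Fin (S.d v))
    (hσ : Function.Injective σ) (hσ' : Function.Injective σ')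
    (hrσσ' : ∀ t, t ∈ Set.range σ ∨ t ∈ Set.range σ') (hdisj : ∀ l m, σ l ≠ σ' m) :
    S.mOld v = (Finset.univ.filter fun l => σ l ∈ S.oldCh v).card +
      (Finset.univ.filter fun m => σ' m ∈ S.oldCh v).card := by
  classical
  unfold GameState.mOld
  have hsplit : S.oldCh v = (Finset.univ.filter fun l => σ l ∈ S.oldCh v).image σ ∪
      (Finset.univ.filter fun m => σ' m ∈ S.oldCh v).image σ' := by
    ext t
    simp only [Finset.mem_union, Finset.mem_image, Finset.mem_filter, Finset.mem_univ, true_and]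
    constructor
    · intro ht
      rcases hrσσ' t with ⟨l, rfl⟩ | ⟨m, rfl⟩
      · exact Or.inl ⟨l, ht, rfl⟩
      · exact Or.inr ⟨m, ht, rfl⟩
    · rintro (⟨l, hl, rfl⟩ | ⟨m, hm, rfl⟩)
      · exact hl
      · exact hm
  have hdj : Disjoint ((Finset.univ.filter fun l => σ l ∈ S.oldCh v).image σ)
      ((Finset.univ.filter fun m => σ' m ∈ S.oldCh v).image σ') := by
    rw [Finset.disjoint_left]
    rintro t hl hm
    obtain ⟨l, -, rfl⟩ := Finset.mem_image.mp hl
    obtain ⟨m, -, hm'⟩ := Finset.mem_image.mp hm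
    exact hdisj l m hm'.symm
  have h := congrArg Finset.card hsplit
  rw [Finset.card_union_of_disjoint hdj, Finset.card_image_of_injective _ hσ,
    Finset.card_image_of_injective _ hσ'] at h
  exact h

end Summit.ResolutionOfSingularities.ResolutionOfSingularities.Theorems.RadicialJung.CleanModelsSuffice

end
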